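import Summits.AtomisticToContinuum.HydrodynamicLimit.Theorems.TwoClocksEquilibriumFastWindowLDReductionBounded

/-!
# Window quasi-monotonicity of the window exponential moment
(crux stmt-AtomisticToContinuum-14440 `TwoClocks.EquilibriumFastWindowLD`, line `Sketch`; lead c4)

Helper file (`--supports stmt-AtomisticToContinuum-14440`). For a hard-sphere flow `Φ` on `𝕋³`, a
law `μ` carried by the good set and preserved by every `Φ_t`, a continuous one-body observable `F`,
a tilt `β` and the window exponential moment
`M(w) := ∫⁻ exp(β Σᵢ w⁻¹∫₀ʷ F(Φ_r z i) dr) dμ`: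

* `lintegral_exp_window_le_of_le` — **quasi-monotonicity in the window**: if `M(w) ≤ e^{A}` at one
  window `w > 0` (`A ≥ 0`) and the short windows are a priori bounded, `M(ρ) ≤ e^{B}` for all
  `0 < ρ < w` (`B ≥ 0`; in the applications the static bound, valid at EVERY window), then at every
  longer window `w' ≥ w`: `M(w') ≤ exp(A + B · w/w')`. Proof: write `w' = k w + ρ`, `k = ⌊w'/w⌋ ≥ 1`,
  `0 ≤ ρ < w`; `M(k w) ≤ M(w)` (`lintegral_exp_window_nat_mul_le`, Hölder + invariance) and, if
  `ρ > 0`, `M(k w + ρ) ≤ M(k w)^{kw/w'} M(ρ)^{ρ/w'}` (`lintegral_exp_window_add_le_geomMean`), with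
  `ρ/w' < w/w'`.
* `windowMoment_le_of_le_static` — the instance for the crux's normalisation (global Gibbs law
  `G_N = localGibbsLaw σ a₀ u₀ θ₀ N Φ`, windows `τ (N+1)^{-1/3}`): a one-site Gaussian bound
  `∫⁻ e^{β F(x,·)} dN(u₀,θ₀) ≤ e^{Kβ²}` (the hypothesis of `stub_staticReduction`) and
  `M_N(β, τ) ≤ e^{A}` give `M_N(β, τ') ≤ exp(A + Kβ²(N+1) · τ/τ')` for every `τ' ≥ τ`.
* `windowMoment_eventually_of_exists` — hence the crux's `∃ τ` upgrades to `∀ τ' ≥ τ₀`: if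
  `M_N(β, τ) ≤ e^{ε(N+1)/2}` for `N ≥ N₀` then `M_N(β, τ') ≤ e^{ε(N+1)}` for all `τ' ≥ τ (1 + 2Kβ²/ε)`,
  `N ≥ N₀`.

Only the group property, invariance and the static bound are used (no dynamics). This is the
"common window" device needed whenever two observables whose window bounds hold at different
windows must be combined by Hölder (automatic uniformity of the tilt range, normal-form equivalence
`crux ⟺ W`).
-/

noncomputable section

open MeasureTheory ProbabilityTheory Real Set Filter
open scoped ENNReal BigOperators

namespace Summit.AtomisticToContinuum.HydrodynamicLimit.Theorems.FastWindowRG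

open Literature.Analysis.FluidPDE Literature.MathematicalPhysics.KineticTheory

/-- `x ≤ ofReal (exp B)` and `0 ≤ p` give `x ^ p ≤ ofReal (exp (B p))`. [folklore] -/
theorem rpow_le_ofReal_exp_mul {x : ℝ≥0∞} {B p : ℝ} (hx : x ≤ ENNReal.ofReal (Real.exp B))
    (hp : 0 ≤ p) : x ^ p ≤ ENNReal.ofReal (Real.exp (B * p)) := by
  calc x ^ p ≤ ENNReal.ofReal (Real.exp B) ^ p := ENNReal.rpow_le_rpow hx hp
    _ = ENNReal.ofReal (Real.exp (B * p)) := by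
        rw [ENNReal.ofReal_rpow_of_pos (Real.exp_pos _), ← Real.exp_mul]

/-- **Quasi-monotonicity of the window exponential moment in the window.** For a hard-sphere flow
`Φ` on `𝕋³`, a law `μ` carried by the good set and preserved by every `Φ_t`, a continuous `F`, a tilt
`β`, windows `0 < w ≤ w'`: if `M(w) ≤ e^{A}` with `A ≥ 0` and `M(ρ) ≤ e^{B}` for all `0 < ρ < w` with
`B ≥ 0`, then `M(w') ≤ exp(A + B · w/w')`, where `M(w) = ∫⁻ exp(β Σᵢ w⁻¹∫₀ʷ F(Φ_r z i) dr) dμ`.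
[folklore] -/
theorem lintegral_exp_window_le_of_le {ε : ℝ} {n : ℕ}
    (Φ : HardSphereFlow (Torus.geometry (Fin 3)) ε n) {μ : Measure (Config n (Fin 3) T3)}
    (hμ : μ Φ.goodᶜ = 0) (hinv : ∀ t, MeasurePreserving (Φ.flow t) μ μ)
    {F : T3 × V3 → ℝ} (hF : Continuous F) (β : ℝ) {w w' : ℝ} (hw : 0 < w) (hww' : w ≤ w')
    {A B : ℝ} (hA0 : 0 ≤ A) (hB0 : 0 ≤ B)
    (hA : ∫⁻ z, ENNReal.ofReal (Real.exp (β * ∑ i, w⁻¹ * ∫ r in (0 : ℝ)..w, F (Φ.flow r z i))) ∂μ ≤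
      ENNReal.ofReal (Real.exp A))
    (hB : ∀ ρ : ℝ, 0 < ρ → ρ < w →
      ∫⁻ z, ENNReal.ofReal (Real.exp (β * ∑ i, ρ⁻¹ * ∫ r in (0 : ℝ)..ρ, F (Φ.flow r z i))) ∂μ ≤
        ENNReal.ofReal (Real.exp B)) :
    ∫⁻ z, ENNReal.ofReal (Real.exp (β * ∑ i, w'⁻¹ * ∫ r in (0 : ℝ)..w', F (Φ.flow r z i))) ∂μ ≤
      ENNReal.ofReal (Real.exp (A + B * (w / w'))) := by
  have hw' : 0 < w' := hw.trans_le hww'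
  -- `w' = k w + ρ` with `k = ⌊w'/w⌋ ≥ 1`, `0 ≤ ρ < w`
  set k : ℕ := ⌊w' / w⌋₊ with hk
  have hk1 : 1 ≤ k := by
    rw [hk, Nat.one_le_floor_iff, le_div_iff₀ hw, one_mul]
    exact hww'
  have hkpos : (0 : ℝ) < k := by exact_mod_cast hk1
  have hkw_le : (k : ℝ) * w ≤ w' := by
    have := Nat.floor_le (div_nonneg hw'.le hw.le) (R := ℝ)
    rw [← hk] at this
    calc (k : ℝ) * w ≤ w' / w * w := mul_le_mul_of_nonneg_right this hw.le
      _ = w' := div_mul_cancel₀ w' hw.ne'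
  have hlt : w' < ((k : ℝ) + 1) * w := by
    have := Nat.lt_floor_add_one (w' / w)
    rw [← hk] at this
    calc w' = w' / w * w := (div_mul_cancel₀ w' hw.ne').symm
      _ < ((k : ℝ) + 1) * w := mul_lt_mul_of_pos_right this hw
  set ρ : ℝ := w' - (k : ℝ) * w with hρ
  have hρ0 : 0 ≤ ρ := sub_nonneg.2 hkw_le
  have hρw : ρ < w := by rw [hρ]; linarith
  -- the moment at `k w` is at most the one at `w`
  have hkw := lintegral_exp_window_nat_mul_le Φ hμ hw hinv hF β k hk1
  have hMkw : ∫⁻ z, ENNReal.ofReal (Real.exp (β * ∑ i, ((k : ℝ) * w)⁻¹ *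
      ∫ r in (0 : ℝ)..((k : ℝ) * w), F (Φ.flow r z i))) ∂μ ≤ ENNReal.ofReal (Real.exp A) :=
    hkw.trans hA
  -- the target bound dominates `e^{A}`
  have hAB : ENNReal.ofReal (Real.exp A) ≤ ENNReal.ofReal (Real.exp (A + B * (w / w'))) :=
    ENNReal.ofReal_le_ofReal (Real.exp_le_exp.2 (le_add_of_nonneg_right (by positivity)))
  rcases hρ0.eq_or_lt with hρ00 | hρpos
  · -- `ρ = 0`: `w' = k w`
    have hw'eq : w' = (k : ℝ) * w := by rw [hρ] at hρ00; linarith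
    calc ∫⁻ z, ENNReal.ofReal (Real.exp (β * ∑ i, w'⁻¹ * ∫ r in (0 : ℝ)..w', F (Φ.flow r z i))) ∂μ
        = ∫⁻ z, ENNReal.ofReal (Real.exp (β * ∑ i, ((k : ℝ) * w)⁻¹ *
            ∫ r in (0 : ℝ)..((k : ℝ) * w), F (Φ.flow r z i))) ∂μ := by rw [hw'eq]
      _ ≤ ENNReal.ofReal (Real.exp A) := hMkw
      _ ≤ ENNReal.ofReal (Real.exp (A + B * (w / w'))) := hAB
  · -- `ρ > 0`: Hölder + invariance at `(k w, ρ)`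
    have hkw0 : 0 < (k : ℝ) * w := mul_pos hkpos hw
    have h := lintegral_exp_window_add_le_geomMean Φ hμ hkw0 hρpos (hinv _) hF β
    have hsum : (k : ℝ) * w + ρ = w' := by rw [hρ]; ring
    rw [hsum] at h
    refine h.trans ?_
    have ha0 : 0 ≤ (k : ℝ) * w / w' := by positivity
    have ha1 : (k : ℝ) * w / w' ≤ 1 := by rwa [div_le_one hw']
    have hb0 : 0 ≤ ρ / w' := by positivity
    have hbw : ρ / w' ≤ w / w' := div_le_div_of_nonneg_right hρw.le hw'.le
    calc (∫⁻ z, ENNReal.ofReal (Real.exp (β * ∑ i, ((k : ℝ) * w)⁻¹ *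
            ∫ r in (0 : ℝ)..((k : ℝ) * w), F (Φ.flow r z i))) ∂μ) ^ ((k : ℝ) * w / w') *
          (∫⁻ z, ENNReal.ofReal (Real.exp (β * ∑ i, ρ⁻¹ *
            ∫ r in (0 : ℝ)..ρ, F (Φ.flow r z i))) ∂μ) ^ (ρ / w')
        ≤ ENNReal.ofReal (Real.exp A) * ENNReal.ofReal (Real.exp (B * (ρ / w'))) := by
          gcongr
          · exact rpow_le_ofReal_exp_of_le_of_nonneg hMkw le_rfl hA0 ha0 ha1
          · exact rpow_le_ofReal_exp_mul (hB ρ hρpos hρw) hb0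
      _ ≤ ENNReal.ofReal (Real.exp A) * ENNReal.ofReal (Real.exp (B * (w / w'))) := by
          gcongr
      _ = ENNReal.ofReal (Real.exp (A + B * (w / w'))) := by
          rw [← ENNReal.ofReal_mul (Real.exp_nonneg _), ← Real.exp_add]

/-- **The instance for the crux's normalisation.** Under the homogeneous Gibbs law
`G_N = localGibbsLaw σ a₀ u₀ θ₀ N Φ` (`σ ≤ 1/2`), with the one-site Gaussian bound
`∫⁻ e^{β F(x,·)} dN(u₀, θ₀) ≤ e^{Kβ²}` (`K ≥ 0`) of `stub_staticReduction`: if the window moment at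
window `τ (N+1)^{-1/3}` is at most `e^{A}` (`A ≥ 0`), then at every window `τ' (N+1)^{-1/3}`,
`τ' ≥ τ`, it is at most `exp(A + Kβ²(N+1) · τ/τ')`. [folklore] -/
theorem windowMoment_le_of_le_static {a₀ θ₀ : ℝ} (ha : 0 < a₀) (hθ : 0 < θ₀) (u₀ : V3) {σ : ℝ}
    (hσ2 : σ ≤ 1 / 2) (N : ℕ)
    (Φ : HardSphereFlow (Torus.geometry (Fin 3)) (hsDiameter σ N) (N + 1))
    {F : T3 × V3 → ℝ} (hF : Continuous F) {β K : ℝ} (hK : 0 ≤ K)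
    (hone : ∀ x : T3, ∫⁻ v, ENNReal.ofReal (Real.exp (β * F (x, v))) ∂(gaussMeasure u₀ θ₀) ≤
      ENNReal.ofReal (Real.exp (K * β ^ 2)))
    {τ τ' : ℝ} (hτ : 0 < τ) (hττ' : τ ≤ τ') {A : ℝ} (hA0 : 0 ≤ A)
    (hA : ∫⁻ z, ENNReal.ofReal (Real.exp (β * ∑ i : Fin (N + 1),
        (τ * ((N : ℝ) + 1) ^ (-(1 / 3 : ℝ)))⁻¹ *
          ∫ r in (0 : ℝ)..(τ * ((N : ℝ) + 1) ^ (-(1 / 3 : ℝ))), F (Φ.flow r z i)))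
      ∂(localGibbsLaw σ (fun _ => a₀) (fun _ => u₀) (fun _ => θ₀) N Φ) ≤
      ENNReal.ofReal (Real.exp A)) :
    ∫⁻ z, ENNReal.ofReal (Real.exp (β * ∑ i : Fin (N + 1),
        (τ' * ((N : ℝ) + 1) ^ (-(1 / 3 : ℝ)))⁻¹ *
          ∫ r in (0 : ℝ)..(τ' * ((N : ℝ) + 1) ^ (-(1 / 3 : ℝ))), F (Φ.flow r z i)))
      ∂(localGibbsLaw σ (fun _ => a₀) (fun _ => u₀) (fun _ => θ₀) N Φ) ≤
      ENNReal.ofReal (Real.exp (A + K * β ^ 2 * ((N : ℝ) + 1) * (τ / τ'))) := by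
  have hc : 0 < ((N : ℝ) + 1) ^ (-(1 / 3 : ℝ)) := Real.rpow_pos_of_pos (by positivity) _
  have hw : 0 < τ * ((N : ℝ) + 1) ^ (-(1 / 3 : ℝ)) := mul_pos hτ hc
  have hww' : τ * ((N : ℝ) + 1) ^ (-(1 / 3 : ℝ)) ≤ τ' * ((N : ℝ) + 1) ^ (-(1 / 3 : ℝ)) :=
    mul_le_mul_of_nonneg_right hττ' hc.le
  have hB0 : 0 ≤ K * β ^ 2 * ((N : ℝ) + 1) := by positivity
  -- the static bound at every window `ρ = (ρ / c_N) c_N`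
  have hB : ∀ ρ : ℝ, 0 < ρ → ρ < τ * ((N : ℝ) + 1) ^ (-(1 / 3 : ℝ)) →
      ∫⁻ z, ENNReal.ofReal (Real.exp (β * ∑ i, ρ⁻¹ * ∫ r in (0 : ℝ)..ρ, F (Φ.flow r z i)))
        ∂(localGibbsLaw σ (fun _ => a₀) (fun _ => u₀) (fun _ => θ₀) N Φ) ≤
        ENNReal.ofReal (Real.exp (K * β ^ 2 * ((N : ℝ) + 1))) := by
    intro ρ hρ _
    have h := stub_staticReduction ha hθ u₀ hσ2 N Φ hF hone (τ := ρ / ((N : ℝ) + 1) ^ (-(1 / 3 : ℝ)))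
      (div_pos hρ hc)
    rwa [div_mul_cancel₀ ρ hc.ne'] at h
  have h := lintegral_exp_window_le_of_le Φ (localGibbsLaw_const_compl_good σ a₀ θ₀ u₀ N Φ)
    (measurePreserving_flow_localGibbsLaw_const σ a₀ θ₀ u₀ N Φ) hF β hw hww' hA0 hB0 hA hB
  have hratio : τ * ((N : ℝ) + 1) ^ (-(1 / 3 : ℝ)) / (τ' * ((N : ℝ) + 1) ^ (-(1 / 3 : ℝ))) = τ / τ' := by
    rw [mul_div_mul_right _ _ hc.ne']
  rwa [hratio] at h

/-- **`∃ τ` upgrades to `∀ τ' ≥ τ₀`.** Under the hypotheses of `windowMoment_le_of_le_static`, if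
`M_N(β, τ) ≤ e^{(ε/2)(N+1)}` for all `N ≥ N₀` (`ε > 0`), then `M_N(β, τ') ≤ e^{ε(N+1)}` for all
`τ' ≥ τ (1 + 2Kβ²/ε)` and all `N ≥ N₀`. [folklore] -/
theorem windowMoment_eventually_of_exists :
    ∀ {a₀ θ₀ : ℝ}, 0 < a₀ → 0 < θ₀ → ∀ (u₀ : V3) {σ : ℝ}, σ ≤ 1 / 2 →
    ∀ (Φ : (N : ℕ) → HardSphereFlow (Torus.geometry (Fin 3)) (hsDiameter σ N) (N + 1))
    {F : T3 × V3 → ℝ}, Continuous F → ∀ {β K : ℝ}, 0 ≤ K →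
    (∀ x : T3, ∫⁻ v, ENNReal.ofReal (Real.exp (β * F (x, v))) ∂(gaussMeasure u₀ θ₀) ≤
      ENNReal.ofReal (Real.exp (K * β ^ 2))) →
    ∀ {ε τ : ℝ}, 0 < ε → 0 < τ → ∀ {N₀ : ℕ},
    (∀ N : ℕ, N₀ ≤ N → ∫⁻ z, ENNReal.ofReal (Real.exp (β * ∑ i : Fin (N + 1),
        (τ * ((N : ℝ) + 1) ^ (-(1 / 3 : ℝ)))⁻¹ *
          ∫ r in (0 : ℝ)..(τ * ((N : ℝ) + 1) ^ (-(1 / 3 : ℝ))), F ((Φ N).flow r z i)))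
      ∂(localGibbsLaw σ (fun _ => a₀) (fun _ => u₀) (fun _ => θ₀) N (Φ N)) ≤
      ENNReal.ofReal (Real.exp (ε / 2 * ((N : ℝ) + 1)))) →
    ∀ τ' : ℝ, τ * (1 + 2 * K * β ^ 2 / ε) ≤ τ' → ∀ N : ℕ, N₀ ≤ N →
      ∫⁻ z, ENNReal.ofReal (Real.exp (β * ∑ i : Fin (N + 1),
        (τ' * ((N : ℝ) + 1) ^ (-(1 / 3 : ℝ)))⁻¹ *
          ∫ r in (0 : ℝ)..(τ' * ((N : ℝ) + 1) ^ (-(1 / 3 : ℝ))), F ((Φ N).flow r z i)))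
      ∂(localGibbsLaw σ (fun _ => a₀) (fun _ => u₀) (fun _ => θ₀) N (Φ N)) ≤
      ENNReal.ofReal (Real.exp (ε * ((N : ℝ) + 1))) := by
  intro a₀ θ₀ ha hθ u₀ σ hσ2 Φ F hF β K hK hone ε τ hε hτ N₀ hN τ' hτ' N hNN
  have hq : 0 ≤ 2 * K * β ^ 2 / ε := by positivity
  have hττ' : τ ≤ τ' := le_trans (le_mul_of_one_le_right hτ.le (le_add_of_nonneg_right hq)) hτ'
  have hτ'pos : 0 < τ' := hτ.trans_le hττ'
  have hA0 : 0 ≤ ε / 2 * ((N : ℝ) + 1) := by positivity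
  have h := windowMoment_le_of_le_static ha hθ u₀ hσ2 N (Φ N) hF hK hone hτ hττ' hA0 (hN N hNN)
  refine h.trans (ENNReal.ofReal_le_ofReal (Real.exp_le_exp.2 ?_))
  -- `ε/2 (N+1) + Kβ²(N+1) τ/τ' ≤ ε (N+1)` since `Kβ² τ/τ' ≤ ε/2`
  have hkey : K * β ^ 2 * (τ / τ') ≤ ε / 2 := by
    have h1 : τ * (2 * K * β ^ 2 / ε) ≤ τ' := by
      refine le_trans ?_ hτ'
      have : 0 ≤ τ * 1 := by positivity
      nlinarith [mul_add τ 1 (2 * K * β ^ 2 / ε)]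
    have h2 : 2 * K * β ^ 2 * τ / ε ≤ τ' := by
      calc 2 * K * β ^ 2 * τ / ε = τ * (2 * K * β ^ 2 / ε) := by ring
        _ ≤ τ' := h1
    rw [div_le_iff₀ hε] at h2
    rw [mul_div_assoc', div_le_iff₀ hτ'pos]
    nlinarith [h2]
  have hN1 : 0 ≤ (N : ℝ) + 1 := by positivity
  calc ε / 2 * ((N : ℝ) + 1) + K * β ^ 2 * ((N : ℝ) + 1) * (τ / τ')
      = (ε / 2 + K * β ^ 2 * (τ / τ')) * ((N : ℝ) + 1) := by ring
    _ ≤ (ε / 2 + ε / 2) * ((N : ℝ) + 1) := by gcongr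
    _ = ε * ((N : ℝ) + 1) := by ring

end Summit.AtomisticToContinuum.HydrodynamicLimit.Theorems.FastWindowRG

end
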